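import Mathlib
import Summits.NavierStokesRegularity.NavierStokesRegularity.Theorems.SubOnsagerCeilingSideBranchWitness
import Literature.Analysis.FluidPDE.Tao2016AveragedNS.WeightedLatticeFlows
import Literature.Analysis.FluidPDE.TaoCascadeNoLow
import HarnessLib

/-!
# Route SubOnsagerCeiling — equations of motion of the side-branch table `α_SB` and the
# POCKET METER (helper file for item stmt-NavierStokesRegularity-25507 `OrthantTailCeiling`;
# `--supports`)

`sideBranchTable` (`Theorems/SubOnsagerCeilingDefs.lean`; admissibility for the crux in
`Theorems/SubOnsagerCeilingSideBranchWitness.lean`) couples, on Tao's lattice with gains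
`Λ_k = (1+ε₀)^{5k/2}` and damping `ν_k = ν(1+ε₀)^{2k}`, a chain `x_k = X_{0,k}`, a side mode
`s_k = X_{1,k}` and a dead-end pocket `z_k = X_{2,k}` (`X_{3,k}` is idle, `quadTerm_{3,k} = 0`):

  `ẋ_k = Λ_{k-1} x_{k-1}² − Λ_k x_k x_{k+1} − (1/5)Λ_k x_k s_k − ν_k x_k`   (`sideBranch_quadTerm_zero`)
  `ṡ_k = (1/5)Λ_k x_k² − (1/5)Λ_k s_k z_{k+1} − ν_k s_k`                 (`sideBranch_quadTerm_one`)
  `ż_k = (1/5)Λ_{k-1} s_{k-1}² − ν_k z_k`                                (`sideBranch_quadTerm_two`)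

and its bond flux is `Π_k = botSum = Λ_k (x_k² x_{k+1} + (1/5) s_k² z_{k+1})` (`sideBranch_botSum`).
Along ANY regular solution on `[0,s]` (continuous modes, one-sided derivatives within `[0,s]`;
no sign condition) this file integrates three consequences used by the negative lemma
`Theorems/SubOnsagerCeilingOrthantTailCeiling/Negative/…FalseOfSideBranchEscape.lean`:
* `sideBranch_pocket_meter` — THE POCKET METERS THE SIDE MODE:
  `(1/5)Λ_k ∫₀ᵗ s_k² ≤ e^{ν_{k+1} t} · z_{k+1}(t)` (Duhamel for `ż_{k+1}`, pocket empty at `0`);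
* `sideBranch_side_meter` — THE SIDE MODE METERS THE CHAIN:
  `(1/5)Λ_k ∫₀ᵗ x_k² ≤ |s_k(t)| + ((1/5)Λ_k Z + ν_k) ∫₀ᵗ |s_k|` whenever `|z_{k+1}| ≤ Z` on `[0,s]`;
* `sideBranch_block_budget` — BLOCK ENERGY BUDGET: the energy of the shells `0..K` drops by at
  most `∫₀ᵗ Π_K + 2ν_K·E_max·t` (telescoping of the cancelling nonlinearity, Tao (4.3)),
  and `sideBranch_integral_botSum_le` — `∫₀ᵗ Π_K ≤ a·(Λ_K∫x_K² + (1/5)Λ_K∫s_K²)` when the two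
  receiving modes at shell `K+1` are bounded by `a`.

HONEST FRAMING: elementary real analysis of a Tao-type MODEL lattice ODE (route SubOnsagerCeiling,
rung TL-M2Break); nothing here bears on Navier–Stokes regularity; no crux is settled here.
-/

noncomputable section

-- the sub-problem namespace `NavierStokesRegularity.NavierStokesRegularity` is the tree's layout (D-0017)
set_option linter.dupNamespace false

namespace Summit.NavierStokesRegularity.NavierStokesRegularity.Theorems.SubOnsagerCeiling

open Set Filter MeasureTheory intervalIntegral
open scoped Topology
open Literature.Analysis.FluidPDE.TaoCascade

/-! ## The nonlinearity of `α_SB`, component by component -/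

/-- Chain component: `quadTerm_{0,n} = Λ_{n-1} x_{n-1}² − Λ_n x_n x_{n+1} − (1/5)Λ_n x_n s_n`.
[this file] -/
theorem sideBranch_quadTerm_zero (ε₀ : ℝ) (X : Fin 4 → ℤ → ℝ → ℝ) (n : ℤ) (t : ℝ) :
    quadTerm ε₀ sideBranchTable X 0 n t =
      (1 + ε₀) ^ ((5 : ℝ) * ((n : ℝ) - 1) / 2) * X 0 (n - 1) t ^ 2 -
        (1 + ε₀) ^ ((5 : ℝ) * n / 2) * (X 0 n t * X 0 (n + 1) t) -
        (1 / 5 : ℝ) * (1 + ε₀) ^ ((5 : ℝ) * n / 2) * (X 0 n t * X 1 n t) := by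
  rw [quadTerm_four_shifts]
  simp [Fin.sum_univ_four, sideBranchTable_feed, sideBranchTable_up1, sideBranchTable_up2,
    sideBranchTable_inshell]
  ring

/-- Side component: `quadTerm_{1,n} = (1/5)Λ_n x_n² − (1/5)Λ_n s_n z_{n+1}`. [this file] -/
theorem sideBranch_quadTerm_one (ε₀ : ℝ) (X : Fin 4 → ℤ → ℝ → ℝ) (n : ℤ) (t : ℝ) :
    quadTerm ε₀ sideBranchTable X 1 n t =
      (1 / 5 : ℝ) * (1 + ε₀) ^ ((5 : ℝ) * n / 2) * X 0 n t ^ 2 -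
        (1 / 5 : ℝ) * (1 + ε₀) ^ ((5 : ℝ) * n / 2) * (X 1 n t * X 2 (n + 1) t) := by
  rw [quadTerm_four_shifts]
  simp [Fin.sum_univ_four, sideBranchTable_feed, sideBranchTable_up1, sideBranchTable_up2,
    sideBranchTable_inshell]
  ring

/-- Pocket component: `quadTerm_{2,n} = (1/5)Λ_{n-1} s_{n-1}²` (a dead end: nothing drains it).
[this file] -/
theorem sideBranch_quadTerm_two (ε₀ : ℝ) (X : Fin 4 → ℤ → ℝ → ℝ) (n : ℤ) (t : ℝ) :
    quadTerm ε₀ sideBranchTable X 2 n t =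
      (1 / 5 : ℝ) * (1 + ε₀) ^ ((5 : ℝ) * ((n : ℝ) - 1) / 2) * X 1 (n - 1) t ^ 2 := by
  rw [quadTerm_four_shifts]
  simp [Fin.sum_univ_four, sideBranchTable_feed, sideBranchTable_up1, sideBranchTable_up2,
    sideBranchTable_inshell]
  ring

/-- Pocket component at shell `k+1`, indexed by the feeding shell `k`:
`quadTerm_{2,k+1} = (1/5)Λ_k s_k²`. [this file] -/
theorem sideBranch_quadTerm_two_succ (ε₀ : ℝ) (X : Fin 4 → ℤ → ℝ → ℝ) (k : ℤ) (t : ℝ) :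
    quadTerm ε₀ sideBranchTable X 2 (k + 1) t =
      (1 / 5 : ℝ) * (1 + ε₀) ^ ((5 : ℝ) * k / 2) * X 1 k t ^ 2 := by
  rw [sideBranch_quadTerm_two, add_sub_cancel_right]
  push_cast
  ring_nf

/-- Bond flux of `α_SB` through `n → n+1`: `Π_n = Λ_n (x_n² x_{n+1} + (1/5) s_n² z_{n+1})`.
[this file] -/
theorem sideBranch_botSum (ε₀ : ℝ) (X : Fin 4 → ℤ → ℝ → ℝ) (n : ℤ) (t : ℝ) :
    botSum ε₀ sideBranchTable X n t =
      (1 + ε₀) ^ ((5 : ℝ) * n / 2) * (X 0 n t ^ 2 * X 0 (n + 1) t) +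
        (1 / 5 : ℝ) * (1 + ε₀) ^ ((5 : ℝ) * n / 2) * (X 1 n t ^ 2 * X 2 (n + 1) t) := by
  simp [botSum, Fin.sum_univ_four, sideBranchTable_feed]
  ring

/-! ## Two pieces of calculus -/

/-- Monotonicity from a non-positive one-sided derivative on `[0,s]`: `Φ t ≤ Φ 0`. [folklore] -/
theorem sideBranch_le_init_of_deriv_nonpos {Φ Φ' : ℝ → ℝ} {s t : ℝ}
    (hder : ∀ u ∈ Icc (0 : ℝ) s, HasDerivWithinAt Φ (Φ' u) (Icc 0 s) u)
    (hle : ∀ u ∈ Icc (0 : ℝ) s, Φ' u ≤ 0) (ht : t ∈ Icc (0 : ℝ) s) : Φ t ≤ Φ 0 := by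
  have hs : (0 : ℝ) ≤ s := ht.1.trans ht.2
  have hcont : ContinuousOn Φ (Icc 0 s) := fun u hu => (hder u hu).continuousWithinAt
  have hdiff : DifferentiableOn ℝ Φ (interior (Icc 0 s)) := fun u hu => by
    rw [interior_Icc] at hu
    exact ((hder u ⟨hu.1.le, hu.2.le⟩).hasDerivAt
      (Icc_mem_nhds hu.1 hu.2)).differentiableAt.differentiableWithinAt
  have hle' : ∀ u ∈ interior (Icc (0 : ℝ) s), deriv Φ u ≤ 0 := fun u hu => by
    rw [interior_Icc] at hu
    rw [((hder u ⟨hu.1.le, hu.2.le⟩).hasDerivAt (Icc_mem_nhds hu.1 hu.2)).deriv]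
    exact hle u ⟨hu.1.le, hu.2.le⟩
  have h := (convex_Icc (0 : ℝ) s).image_sub_le_mul_sub_of_deriv_le hcont hdiff hle' 0
    (left_mem_Icc.2 hs) t ht ht.1
  have h' : Φ t - Φ 0 ≤ 0 := by simpa using h
  linarith

/-- `|x| ≤ δ/2 + x²/(2δ)` for `δ > 0`. [folklore] -/
theorem sideBranch_abs_le_amgm {δ : ℝ} (hδ : 0 < δ) (x : ℝ) :
    |x| ≤ δ / 2 + x ^ 2 / (2 * δ) := by
  have h1 : δ / 2 + x ^ 2 / (2 * δ) = (δ ^ 2 + x ^ 2) / (2 * δ) := by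
    field_simp
  rw [h1, le_div_iff₀ (by positivity)]
  nlinarith [sq_nonneg (|x| - δ), sq_abs x, abs_nonneg x]

/-! ## Integrated consequences along a regular solution of the `ν`-viscous `α_SB` lattice -/

section Solution

variable {ε₀ ν s : ℝ} {X : Fin 4 → ℤ → ℝ → ℝ}

/-- **The pocket meters the side mode.** Along a regular solution on `[0,s]` whose pocket at shell
`k+1` is empty at time `0`: `(1/5)Λ_k ∫₀ᵗ s_k² ≤ e^{ν_{k+1} t} z_{k+1}(t)` for `t ∈ [0,s]`
(`u ↦ (1/5)Λ_k∫₀ᵘ s_k² − e^{ν_{k+1}u} z_{k+1}(u)` has derivative `(1/5)Λ_k s_k²(1 − e^{ν_{k+1}u}) ≤ 0`).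
[this file] -/
theorem sideBranch_pocket_meter (hε : 0 < ε₀) (hν : 0 ≤ ν)
    (hcont : ∀ (i : Fin 4) (k : ℤ), Continuous (X i k))
    (hder : ∀ (i : Fin 4) (k : ℤ), ∀ t ∈ Icc (0 : ℝ) s, HasDerivWithinAt (X i k)
      (quadTerm ε₀ sideBranchTable X i k t - ν * (1 + ε₀) ^ ((2 : ℝ) * k) * X i k t)
      (Icc (0 : ℝ) s) t)
    (k : ℤ) (h0 : X 2 (k + 1) 0 = 0) {t : ℝ} (ht : t ∈ Icc (0 : ℝ) s) :
    (1 / 5 : ℝ) * (1 + ε₀) ^ ((5 : ℝ) * k / 2) * (∫ u in (0 : ℝ)..t, X 1 k u ^ 2) ≤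
      Real.exp (ν * (1 + ε₀) ^ ((2 : ℝ) * ((k + 1 : ℤ) : ℝ)) * t) * X 2 (k + 1) t := by
  have hb : (0 : ℝ) < 1 + ε₀ := by linarith
  set c : ℝ := ν * (1 + ε₀) ^ ((2 : ℝ) * ((k + 1 : ℤ) : ℝ)) with hc
  set L : ℝ := (1 / 5 : ℝ) * (1 + ε₀) ^ ((5 : ℝ) * k / 2) with hL
  have hc0 : 0 ≤ c := mul_nonneg hν (Real.rpow_nonneg hb.le _)
  have hL0 : 0 ≤ L := mul_nonneg (by norm_num) (Real.rpow_nonneg hb.le _)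
  -- the pocket equation in closed form
  have hz : ∀ u ∈ Icc (0 : ℝ) s,
      HasDerivWithinAt (X 2 (k + 1)) (L * X 1 k u ^ 2 - c * X 2 (k + 1) u) (Icc 0 s) u := by
    intro u hu
    have h := hder 2 (k + 1) u hu
    rw [sideBranch_quadTerm_two_succ] at h
    exact h
  -- the comparison function
  have hsq : Continuous fun u => X 1 k u ^ 2 := (hcont 1 k).pow 2
  set Φ : ℝ → ℝ := fun u => L * (∫ x in (0 : ℝ)..u, X 1 k x ^ 2) -
    Real.exp (c * u) * X 2 (k + 1) u with hΦ
  have hderΦ : ∀ u ∈ Icc (0 : ℝ) s, HasDerivWithinAt Φ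
      (L * X 1 k u ^ 2 * (1 - Real.exp (c * u))) (Icc 0 s) u := by
    intro u hu
    have h1 := ((hsq.integral_hasStrictDerivAt 0 u).hasDerivAt).hasDerivWithinAt
      (s := Icc (0 : ℝ) s)
    have h2 : HasDerivWithinAt (fun x => Real.exp (c * x)) (Real.exp (c * u) * c) (Icc 0 s) u :=
      ((Real.hasDerivAt_exp (c * u)).comp u
        ((hasDerivAt_id u).const_mul c)).hasDerivWithinAt.congr_deriv (by simp)
    have h3 := (h1.const_mul L).sub (h2.mul (hz u hu))
    refine h3.congr_deriv ?_
    ring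
  have hle : ∀ u ∈ Icc (0 : ℝ) s, L * X 1 k u ^ 2 * (1 - Real.exp (c * u)) ≤ 0 := by
    intro u hu
    have h1 : 1 ≤ Real.exp (c * u) := Real.one_le_exp (mul_nonneg hc0 hu.1)
    have h2 : 0 ≤ L * X 1 k u ^ 2 := mul_nonneg hL0 (sq_nonneg _)
    nlinarith
  have h := sideBranch_le_init_of_deriv_nonpos hderΦ hle ht
  simp only [hΦ, integral_same, mul_zero, Real.exp_zero, h0, sub_zero] at h
  linarith

/-- **The side mode meters the chain.** Along a regular solution on `[0,s]` whose side mode at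
shell `k` is empty at time `0`, if `|z_{k+1}| ≤ Z` on `[0,s]` then for `t ∈ [0,s]`
`(1/5)Λ_k ∫₀ᵗ x_k² ≤ |s_k(t)| + ((1/5)Λ_k Z + ν_k) ∫₀ᵗ |s_k|` (integrate the side equation and
bound its two drains). [this file] -/
theorem sideBranch_side_meter (hε : 0 < ε₀) (hν : 0 ≤ ν)
    (hcont : ∀ (i : Fin 4) (k : ℤ), Continuous (X i k))
    (hder : ∀ (i : Fin 4) (k : ℤ), ∀ t ∈ Icc (0 : ℝ) s, HasDerivWithinAt (X i k)
      (quadTerm ε₀ sideBranchTable X i k t - ν * (1 + ε₀) ^ ((2 : ℝ) * k) * X i k t)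
      (Icc (0 : ℝ) s) t)
    (k : ℤ) (h0 : X 1 k 0 = 0) {Z : ℝ} (hZ : ∀ u ∈ Icc (0 : ℝ) s, |X 2 (k + 1) u| ≤ Z)
    {t : ℝ} (ht : t ∈ Icc (0 : ℝ) s) :
    (1 / 5 : ℝ) * (1 + ε₀) ^ ((5 : ℝ) * k / 2) * (∫ u in (0 : ℝ)..t, X 0 k u ^ 2) ≤
      |X 1 k t| + ((1 / 5 : ℝ) * (1 + ε₀) ^ ((5 : ℝ) * k / 2) * Z + ν * (1 + ε₀) ^ ((2 : ℝ) * k)) *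
        ∫ u in (0 : ℝ)..t, |X 1 k u| := by
  have hb : (0 : ℝ) < 1 + ε₀ := by linarith
  set c : ℝ := ν * (1 + ε₀) ^ ((2 : ℝ) * (k : ℝ)) with hc
  set L : ℝ := (1 / 5 : ℝ) * (1 + ε₀) ^ ((5 : ℝ) * k / 2) with hL
  have hc0 : 0 ≤ c := mul_nonneg hν (Real.rpow_nonneg hb.le _)
  have hL0 : 0 ≤ L := mul_nonneg (by norm_num) (Real.rpow_nonneg hb.le _)
  have hZ0 : 0 ≤ Z := (abs_nonneg _).trans (hZ 0 (left_mem_Icc.2 (ht.1.trans ht.2)))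
  -- the side equation in closed form
  have hsd : ∀ u ∈ Icc (0 : ℝ) s, HasDerivWithinAt (X 1 k)
      (L * X 0 k u ^ 2 - L * (X 1 k u * X 2 (k + 1) u) - c * X 1 k u) (Icc 0 s) u := by
    intro u hu
    have h := hder 1 k u hu
    rw [sideBranch_quadTerm_one] at h
    exact h
  have hsq : Continuous fun u => X 0 k u ^ 2 := (hcont 0 k).pow 2
  have habs : Continuous fun u => |X 1 k u| := (hcont 1 k).abs
  set Φ : ℝ → ℝ := fun u => L * (∫ x in (0 : ℝ)..u, X 0 k x ^ 2) - X 1 k u -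
    (L * Z + c) * ∫ x in (0 : ℝ)..u, |X 1 k x| with hΦ
  have hderΦ : ∀ u ∈ Icc (0 : ℝ) s, HasDerivWithinAt Φ
      (L * (X 1 k u * X 2 (k + 1) u) + c * X 1 k u - (L * Z + c) * |X 1 k u|) (Icc 0 s) u := by
    intro u hu
    have h1 := ((hsq.integral_hasStrictDerivAt 0 u).hasDerivAt).hasDerivWithinAt
      (s := Icc (0 : ℝ) s)
    have h2 := ((habs.integral_hasStrictDerivAt 0 u).hasDerivAt).hasDerivWithinAt
      (s := Icc (0 : ℝ) s)
    have h3 := ((h1.const_mul L).sub (hsd u hu)).sub (h2.const_mul (L * Z + c))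
    refine h3.congr_deriv ?_
    ring
  have hle : ∀ u ∈ Icc (0 : ℝ) s,
      L * (X 1 k u * X 2 (k + 1) u) + c * X 1 k u - (L * Z + c) * |X 1 k u| ≤ 0 := by
    intro u hu
    have h1 : X 1 k u * X 2 (k + 1) u ≤ |X 1 k u| * Z := by
      calc X 1 k u * X 2 (k + 1) u ≤ |X 1 k u * X 2 (k + 1) u| := le_abs_self _
        _ = |X 1 k u| * |X 2 (k + 1) u| := abs_mul _ _
        _ ≤ |X 1 k u| * Z := mul_le_mul_of_nonneg_left (hZ u hu) (abs_nonneg _)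
    have h2 : X 1 k u ≤ |X 1 k u| := le_abs_self _
    nlinarith
  have h := sideBranch_le_init_of_deriv_nonpos hderΦ hle ht
  simp only [hΦ, integral_same, mul_zero, h0, sub_zero] at h
  have h' : X 1 k t ≤ |X 1 k t| := le_abs_self _
  linarith

/-- **`∫|s_k| ≤ δt/2 + ∫s_k²/(2δ)`** (AM–GM under the integral). [folklore] -/
theorem sideBranch_integral_abs_le (hcont : ∀ (i : Fin 4) (k : ℤ), Continuous (X i k))
    (i : Fin 4) (k : ℤ) {δ t : ℝ} (hδ : 0 < δ) (ht : 0 ≤ t) :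
    (∫ u in (0 : ℝ)..t, |X i k u|) ≤ δ / 2 * t + (∫ u in (0 : ℝ)..t, X i k u ^ 2) / (2 * δ) := by
  have h1 : (∫ u in (0 : ℝ)..t, |X i k u|) ≤ ∫ u in (0 : ℝ)..t, (δ / 2 + X i k u ^ 2 / (2 * δ)) :=
    intervalIntegral.integral_mono_on ht ((hcont i k).abs.intervalIntegrable _ _)
      ((continuous_const.add (((hcont i k).pow 2).div_const _)).intervalIntegrable _ _)
      fun u _ => sideBranch_abs_le_amgm hδ _
  have hc0 : Continuous fun _ : ℝ => δ / 2 := continuous_const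
  have hc1 : Continuous fun u => X i k u ^ 2 / (2 * δ) := by have := hcont i k; fun_prop
  have h2 : (∫ u in (0 : ℝ)..t, (δ / 2 + X i k u ^ 2 / (2 * δ))) =
      δ / 2 * t + (∫ u in (0 : ℝ)..t, X i k u ^ 2) / (2 * δ) := by
    rw [intervalIntegral.integral_add (hc0.intervalIntegrable _ _) (hc1.intervalIntegrable _ _),
      intervalIntegral.integral_const, intervalIntegral.integral_div]
    simp [mul_comm]
  linarith

/-- **The flux through `K → K+1` against bounded receivers.** If `|x_{K+1}|, |z_{K+1}| ≤ a` on
`[0,s]` then `∫₀ᵗ Π_K ≤ a · (Λ_K ∫₀ᵗ x_K² + (1/5)Λ_K ∫₀ᵗ s_K²)`. [this file] -/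
theorem sideBranch_integral_botSum_le (hε : 0 < ε₀)
    (hcont : ∀ (i : Fin 4) (k : ℤ), Continuous (X i k)) (K : ℤ) {a : ℝ}
    (ha0 : ∀ u ∈ Icc (0 : ℝ) s, |X 0 (K + 1) u| ≤ a) (ha2 : ∀ u ∈ Icc (0 : ℝ) s, |X 2 (K + 1) u| ≤ a)
    {t : ℝ} (ht : t ∈ Icc (0 : ℝ) s) :
    (∫ u in (0 : ℝ)..t, botSum ε₀ sideBranchTable X K u) ≤
      a * ((1 + ε₀) ^ ((5 : ℝ) * K / 2) * (∫ u in (0 : ℝ)..t, X 0 K u ^ 2) +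
        (1 / 5 : ℝ) * (1 + ε₀) ^ ((5 : ℝ) * K / 2) * ∫ u in (0 : ℝ)..t, X 1 K u ^ 2) := by
  have hb : (0 : ℝ) < 1 + ε₀ := by linarith
  set Λ : ℝ := (1 + ε₀) ^ ((5 : ℝ) * K / 2) with hΛ
  have hΛ0 : 0 ≤ Λ := Real.rpow_nonneg hb.le _
  have hPi : Continuous fun u => botSum ε₀ sideBranchTable X K u := by
    unfold botSum
    fun_prop
  have hg : Continuous fun u => a * Λ * X 0 K u ^ 2 + a * ((1 / 5 : ℝ) * Λ) * X 1 K u ^ 2 := by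
    fun_prop
  have h1 : (∫ u in (0 : ℝ)..t, botSum ε₀ sideBranchTable X K u) ≤
      ∫ u in (0 : ℝ)..t, (a * Λ * X 0 K u ^ 2 + a * ((1 / 5 : ℝ) * Λ) * X 1 K u ^ 2) := by
    refine intervalIntegral.integral_mono_on ht.1 (hPi.intervalIntegrable _ _)
      (hg.intervalIntegrable _ _) fun u hu => ?_
    have hu' : u ∈ Icc (0 : ℝ) s := ⟨hu.1, hu.2.trans ht.2⟩
    rw [sideBranch_botSum]
    have h0 : X 0 (K + 1) u ≤ a := (le_abs_self _).trans (ha0 u hu')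
    have h2 : X 2 (K + 1) u ≤ a := (le_abs_self _).trans (ha2 u hu')
    have e0 : 0 ≤ Λ * X 0 K u ^ 2 := mul_nonneg hΛ0 (sq_nonneg _)
    have e1 : 0 ≤ (1 / 5 : ℝ) * Λ * X 1 K u ^ 2 := by positivity
    nlinarith
  have hf0 : Continuous fun u => a * Λ * X 0 K u ^ 2 := by have := hcont 0 K; fun_prop
  have hf1 : Continuous fun u => a * ((1 / 5 : ℝ) * Λ) * X 1 K u ^ 2 := by
    have := hcont 1 K; fun_prop
  have h2 : (∫ u in (0 : ℝ)..t, (a * Λ * X 0 K u ^ 2 + a * ((1 / 5 : ℝ) * Λ) * X 1 K u ^ 2)) =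
      a * (Λ * (∫ u in (0 : ℝ)..t, X 0 K u ^ 2) +
        (1 / 5 : ℝ) * Λ * ∫ u in (0 : ℝ)..t, X 1 K u ^ 2) := by
    rw [intervalIntegral.integral_add (hf0.intervalIntegrable _ _) (hf1.intervalIntegrable _ _),
      intervalIntegral.integral_const_mul, intervalIntegral.integral_const_mul]
    ring
  linarith

/-- **Block energy budget.** Along a regular solution on `[0,s]` vanishing below shell `0`, if the
energy of the shells `0..K` stays `≤ E_max` on `[0,s]`, then for `t ∈ [0,s]` it drops by at most
the accumulated bond flux plus the block's dissipation:
`B(0) − B(t) ≤ ∫₀ᵗ Π_K + 2 ν_K E_max t`, `B(u) = Σ_{k ≤ K} Σ_i ½X_{i,k}(u)²`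
(derivative `−Π_K − dissipation` by the telescoping `sum_range_sum_quadTerm_mul`, Tao (4.3)).
[this file] -/
theorem sideBranch_block_budget (hε : 0 < ε₀) (hν : 0 ≤ ν)
    (hlow : ∀ (i : Fin 4) (k : ℤ), k < 0 → ∀ t : ℝ, X i k t = 0)
    (hcont : ∀ (i : Fin 4) (k : ℤ), Continuous (X i k))
    (hder : ∀ (i : Fin 4) (k : ℤ), ∀ t ∈ Icc (0 : ℝ) s, HasDerivWithinAt (X i k)
      (quadTerm ε₀ sideBranchTable X i k t - ν * (1 + ε₀) ^ ((2 : ℝ) * k) * X i k t)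
      (Icc (0 : ℝ) s) t)
    (K : ℕ) {Emax : ℝ}
    (hE : ∀ u ∈ Icc (0 : ℝ) s, ∑ k ∈ Finset.range (K + 1), ∑ i : Fin 4,
      (1 / 2 : ℝ) * X i (k : ℤ) u ^ 2 ≤ Emax)
    {t : ℝ} (ht : t ∈ Icc (0 : ℝ) s) :
    (∑ k ∈ Finset.range (K + 1), ∑ i : Fin 4, (1 / 2 : ℝ) * X i (k : ℤ) 0 ^ 2) -
        (∑ k ∈ Finset.range (K + 1), ∑ i : Fin 4, (1 / 2 : ℝ) * X i (k : ℤ) t ^ 2) ≤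
      (∫ u in (0 : ℝ)..t, botSum ε₀ sideBranchTable X K u) +
        2 * (ν * (1 + ε₀) ^ ((2 : ℝ) * (K : ℝ))) * Emax * t := by
  have hb : (0 : ℝ) < 1 + ε₀ := by linarith
  have hb1 : (1 : ℝ) ≤ 1 + ε₀ := by linarith
  set c : ℤ → ℝ := fun k => ν * (1 + ε₀) ^ ((2 : ℝ) * (k : ℝ)) with hc
  have hc0 : ∀ k, 0 ≤ c k := fun k => mul_nonneg hν (Real.rpow_nonneg hb.le _)
  have hcmono : ∀ k : ℕ, k ∈ Finset.range (K + 1) → c k ≤ c K := by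
    intro k hk
    have hk' : (k : ℝ) ≤ K := by exact_mod_cast Nat.lt_succ_iff.1 (Finset.mem_range.1 hk)
    simp only [hc, Int.cast_natCast]
    exact mul_le_mul_of_nonneg_left
      (Real.rpow_le_rpow_of_exponent_le hb1 (by linarith)) hν
  have hEmax : 0 ≤ Emax := le_trans (Finset.sum_nonneg fun k _ => Finset.sum_nonneg fun i _ =>
    by positivity) (hE 0 (left_mem_Icc.2 (ht.1.trans ht.2)))
  -- block energy, its derivative
  set B : ℝ → ℝ := fun u =>
    ∑ k ∈ Finset.range (K + 1), ∑ i : Fin 4, (1 / 2 : ℝ) * X i (k : ℤ) u ^ 2 with hB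
  set D : ℝ → ℝ := fun u => ∑ k ∈ Finset.range (K + 1), ∑ i : Fin 4,
    X i (k : ℤ) u * (quadTerm ε₀ sideBranchTable X i k u - c k * X i k u) with hD
  have hderB : ∀ u ∈ Icc (0 : ℝ) s, HasDerivWithinAt B (D u) (Icc 0 s) u := by
    intro u hu
    simp only [hB, hD]
    refine HasDerivWithinAt.fun_sum fun k _ => HasDerivWithinAt.fun_sum fun i _ => ?_
    have h := ((hder i k u hu).pow 2).const_mul (1 / 2 : ℝ)
    refine h.congr_deriv ?_
    rw [show (2 : ℕ) - 1 = 1 from rfl, pow_one]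
    simp only [hc]
    push_cast
    ring
  -- `D = −Π_K − dissipation ≥ −Π_K − 2 c_K E_max`
  have hDge : ∀ u ∈ Icc (0 : ℝ) s,
      -(botSum ε₀ sideBranchTable X K u) - 2 * c K * Emax ≤ D u := by
    intro u hu
    have hsplit : D u = (∑ k ∈ Finset.range (K + 1), ∑ i : Fin 4,
        quadTerm ε₀ sideBranchTable X i ((0 : ℤ) + k) u * X i ((0 : ℤ) + k) u) -
        ∑ k ∈ Finset.range (K + 1), ∑ i : Fin 4, c k * X i (k : ℤ) u ^ 2 := by
      simp only [hD, zero_add, ← Finset.sum_sub_distrib]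
      refine Finset.sum_congr rfl fun k _ => Finset.sum_congr rfl fun i _ => ?_
      ring
    rw [sum_range_sum_quadTerm_mul ε₀ sideBranchTable_cancelling X 0 (K + 1) u] at hsplit
    have hX1 : ∀ (i : Fin 4) (w : ℝ), X i (-1) w = 0 := fun i w => hlow i (-1) (by norm_num) w
    have htop0 : topSum ε₀ sideBranchTable X (0 - 1) u = 0 := by
      simp [topSum, hX1]
    have hidx : (0 : ℤ) + ((K + 1 : ℕ) : ℤ) - 1 = (K : ℤ) := by push_cast; ring
    rw [htop0, sub_zero, hidx, ← neg_neg (topSum ε₀ sideBranchTable X (K : ℤ) u),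
      ← botSum_eq_neg_topSum ε₀ sideBranchTable_cancelling X (K : ℤ) u] at hsplit
    -- dissipation bound
    have hdiss : ∑ k ∈ Finset.range (K + 1), ∑ i : Fin 4, c k * X i (k : ℤ) u ^ 2 ≤
        2 * c K * Emax := by
      calc ∑ k ∈ Finset.range (K + 1), ∑ i : Fin 4, c k * X i (k : ℤ) u ^ 2
          ≤ ∑ k ∈ Finset.range (K + 1), ∑ i : Fin 4, c K * X i (k : ℤ) u ^ 2 :=
            Finset.sum_le_sum fun k hk => Finset.sum_le_sum fun i _ =>
              mul_le_mul_of_nonneg_right (hcmono k hk) (sq_nonneg _)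
        _ = 2 * c K * B u := by
            simp only [hB, Finset.mul_sum]
            refine Finset.sum_congr rfl fun k _ => Finset.sum_congr rfl fun i _ => ?_
            ring
        _ ≤ 2 * c K * Emax := mul_le_mul_of_nonneg_left (hE u hu) (by positivity)
    linarith
  -- comparison function
  have hPi : Continuous fun u => botSum ε₀ sideBranchTable X K u := by
    unfold botSum
    fun_prop
  set Φ : ℝ → ℝ := fun u => -B u - (∫ x in (0 : ℝ)..u, botSum ε₀ sideBranchTable X K x) -
    2 * c K * Emax * u with hΦ
  have hderΦ : ∀ u ∈ Icc (0 : ℝ) s, HasDerivWithinAt Φ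
      (-D u - botSum ε₀ sideBranchTable X K u - 2 * c K * Emax) (Icc 0 s) u := by
    intro u hu
    have h1 := ((hPi.integral_hasStrictDerivAt 0 u).hasDerivAt).hasDerivWithinAt
      (s := Icc (0 : ℝ) s)
    have h2 := (hasDerivWithinAt_id u (Icc (0 : ℝ) s)).const_mul (2 * c K * Emax)
    have h3 := (((hderB u hu).neg).sub h1).sub h2
    refine h3.congr_deriv ?_
    simp
  have hle : ∀ u ∈ Icc (0 : ℝ) s, -D u - botSum ε₀ sideBranchTable X K u - 2 * c K * Emax ≤ 0 :=
    fun u hu => by linarith [hDge u hu]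
  have h := sideBranch_le_init_of_deriv_nonpos hderΦ hle ht
  simp only [hΦ, integral_same, mul_zero, sub_zero] at h
  have hcK : c K = ν * (1 + ε₀) ^ ((2 : ℝ) * (K : ℝ)) := by simp [hc]
  simp only [hB, hcK] at h ⊢
  linarith

end Solution

end Summit.NavierStokesRegularity.NavierStokesRegularity.Theorems.SubOnsagerCeiling

end
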